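import Mathlib
import Summits.Ventures.HodgeRepro.Tier4.Line4.ArchApproxBump
import Summits.Ventures.HodgeRepro.Tier4.Line4.ArchDistBounds
import Summits.Ventures.HodgeRepro.Tier4.Line4.OrbitDecay
import Summits.Ventures.HodgeRepro.Tier4.Line4.IntegArch

/-!
# Tier4/Line4/ConvInfRegularity — C-L4-CHAININPUTS-ARCH: the archimedean factor `c₀ · (finf ∗ e)` of the (7b) witness is
continuous, bounded and of weight-3 decay, and the two archimedean `ChainInputs` clauses `hA` / `hIinf` follow by name

Blind re-derivation cell `pub-hodge-repro`, Tier 4 «prove the step» (README §9–§10), LINE L4, seat t4-L4-x2 (g0, the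
extra prover seat; L4-p1 g4's YIELD S15794, plan-4 g6's owner line S15814, the `ChainInputs` census S15812).  Tree path
`lean/Summits/Ventures/HodgeRepro/Tier4/Line4/ConvInfRegularity.lean`.  Imports L1-p1's ArchApproxBump (`IsInfFactor`,
`infOf`, **`continuous_convInf_of_isInfFactor`** — the continuity is L1-p1's theorem, consumed by name), L2-p1's
ArchDistBounds (`archDist_mul_le`, `continuous_archDist`), L2-p3's OrbitDecay (`archDist_ofInfPart`) and L1-p5's IntegArch
(`integrable_conj_chi'_mul_Finf`, `integrable_chi_mul_innerInf`).  Mathlib-level; no literature.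

WHAT IS PROVED, for `Finf := fun x => c₀ * convInf W μinf finf e x` (MainTermInstance's archimedean factor of the witness
`f N = (finf ⊗ ffinMu) ⋆ (e ⊗ 1_{K(N)})`, L2-p3's `chainInputs_of_pieces` binders `hFinfc`, `C`/`hC`, `hA`, `hIinf`):
* `continuous_const_mul_convInf` — continuity (L1-p1's `continuous_convInf_of_isInfFactor` times a constant);
* **`norm_convInf_le_exp_of_decay`** — THE DECAY OF THE CONVOLUTION: for `‖finf‖ ≤ C e^{−3 archDist}`, `e` an archimedean
  test factor bounded by `M` with `archDist ≤ cK` on its support `K ⊆ G_∞`,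
  `‖(finf ∗ e)(x)‖ ≤ C e^{3 cK} M μ_∞(K⁻¹) e^{−3 archDist x}` — the integrand `finf(y) e(y⁻¹ x_∞)` vanishes unless
  `y ∈ x_∞ K⁻¹`, where `archDist x ≤ archDist y + cK` (`archDist_mul_le`, `archDist_ofInfPart`), and `μ_∞(x_∞ K⁻¹) = μ_∞(K⁻¹)`
  (left invariance);
* `hasDecay3_convInf`, `hasDecay3_const_mul_convInf` — `HasDecay3 W finf → HasDecay3 W (c₀ · (finf ∗ e))` (the shape display
  (8) `PoincareOfDecay` consumes, L1ClassV3 L129 / L2-p3's `poincareSummable_of_poincareOfDecay`);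
* `exists_norm_const_mul_convInf_le` — the sup bound `∃ C, ∀ x, ‖c₀ · (finf ∗ e)(x)‖ ≤ C` (`e^{−3 archDist} ≤ 1`);
* `integrable_conj_chi'_mul_const_mul_convInf` (= `hA`), `integrable_chi_mul_innerInf_const_mul_convInf` (= `hIinf`) — the
  two archimedean clauses of `ChainInputs` at `Finf`, IntegArch's theorems by name under `[CompactSpace (torusInf W)]`
  `[CompactSpace (torusInf' W)]` (the seesaw instance: L1-p5's `compactSpace_torusInf_seesaw`).

Nothing here says anything about the status of the Hodge conjecture for CM abelian varieties, which is NOT proved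
(HC_CM is NOT proved by anyone in this repository).
-/

set_option autoImplicit false

noncomputable section

namespace Summit.Ventures.HodgeRepro.Tier4.Line4

open Summit.Ventures.HodgeRepro.Tier4 Summit.Ventures.HodgeRepro.Tier4.Common
  Summit.Ventures.HodgeRepro.Tier4.Line1 Summit.Ventures.HodgeRepro.Tier4.Line4.L1Class MeasureTheory

open scoped ComplexConjugate Pointwise

section Decay

variable {k : Type} [Field k] [NumberField k] (W : PlaneData k) [MeasurableSpace (GA W)] [BorelSpace (GA W)]

omit [MeasurableSpace (GA W)] [BorelSpace (GA W)] in
/-- The archimedean distance is bounded on a compact subset of `G_∞`. -/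
theorem exists_forall_archDist_le_of_isCompact {K : Set (infinitePart W)} (hK : IsCompact K) :
    ∃ cK : ℝ, 0 ≤ cK ∧ ∀ y ∈ K, archDist W (y : GA W) ≤ cK := by
  have hcont : ContinuousOn (fun y : infinitePart W => archDist W (y : GA W)) K :=
    ((continuous_archDist W).comp continuous_subtype_val).continuousOn
  obtain ⟨cK, hcK⟩ := hK.exists_bound_of_continuousOn hcont
  refine ⟨max cK 0, le_max_right _ _, fun y hy => ?_⟩
  have h := hcK y hy
  rw [Real.norm_eq_abs] at h
  exact le_trans (le_abs_self _) (le_trans h (le_max_left _ _))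

/-- `c₀ · (finf ∗ e)` is continuous (L1-p1's `continuous_convInf_of_isInfFactor` times a constant). -/
theorem continuous_const_mul_convInf (μinf : Measure (infinitePart W)) [μinf.IsHaarMeasure]
    {finf : GA W → ℂ} (hfinf : Continuous finf) {e : GA W → ℂ} (he : IsInfFactor W e) (c₀ : ℂ) :
    Continuous (fun x => c₀ * convInf W μinf finf e x) :=
  continuous_const.mul (continuous_convInf_of_isInfFactor W μinf hfinf he)

/-- **THE DECAY OF THE CONVOLUTION**: `‖(finf ∗ e)(x)‖ ≤ C e^{3 cK} M μ_∞(K⁻¹) e^{−3 archDist x}` for `‖finf‖ ≤ C e^{−3 archDist}`,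
`‖e‖ ≤ M` on `G_∞`, `K` the support of `e` on `G_∞` with `archDist ≤ cK` on `K`. -/
theorem norm_convInf_le_exp_of_decay (μinf : Measure (infinitePart W)) [μinf.IsHaarMeasure]
    {finf e : GA W → ℂ} {C : ℝ} (hC0 : 0 ≤ C) (hC : ∀ x, ‖finf x‖ ≤ C * Real.exp (-(3 * archDist W x)))
    (he : IsInfFactor W e) {M : ℝ} (hM : ∀ y : infinitePart W, ‖e (y : GA W)‖ ≤ M) {cK : ℝ}
    (hcK : ∀ y ∈ tsupport (fun y : infinitePart W => e (y : GA W)), archDist W (y : GA W) ≤ cK) (x : GA W) :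
    ‖convInf W μinf finf e x‖ ≤
      C * Real.exp (3 * cK) * M * μinf.real (tsupport (fun y : infinitePart W => e (y : GA W)))⁻¹ *
        Real.exp (-(3 * archDist W x)) := by
  haveI := locallyCompact_infinitePart W
  haveI := secondCountable_infinitePart W
  haveI := t2Space_GA W
  have hM0 : 0 ≤ M := le_trans (norm_nonneg _) (hM 1)
  -- the support of the test factor on `G_∞`, named
  obtain ⟨K, hK⟩ : ∃ K : Set (infinitePart W), tsupport (fun y : infinitePart W => e (y : GA W)) = K := ⟨_, rfl⟩
  have hKc : IsCompact K := by
    rw [← hK]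
    exact he.compact
  have hcK' : ∀ y ∈ K, archDist W (y : GA W) ≤ cK := by
    rw [← hK]
    exact hcK
  have hsupp : ∀ y : infinitePart W, e (y : GA W) ≠ 0 → y ∈ K := by
    intro y hy
    rw [← hK]
    exact subset_tsupport _ hy
  rw [hK]
  -- the archimedean coordinate of `x`, named
  obtain ⟨z, hz⟩ : ∃ z : infinitePart W, infOf W x = z := ⟨_, rfl⟩
  have hzx : (z : GA W) = GA.ofInfPart W x := by rw [← hz, coe_infOf]
  have hdz : archDist W (z : GA W) = archDist W x := by rw [hzx, archDist_ofInfPart]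
  have hzK : IsCompact (z • K⁻¹) := (hKc.inv).smul z
  have hzKm : MeasurableSet (z • K⁻¹) := hzK.isClosed.measurableSet
  -- the constant in front, named
  obtain ⟨D, hD⟩ : ∃ D : ℝ, C * Real.exp (3 * cK) * M * Real.exp (-(3 * archDist W x)) = D := ⟨_, rfl⟩
  have hD0 : 0 ≤ D := by
    rw [← hD]
    positivity
  -- the integrand, in terms of `z`
  have hrw : ∀ y : infinitePart W, (y : GA W)⁻¹ * GA.ofInfPart W x = ((y⁻¹ * z : infinitePart W) : GA W) := by
    intro y
    rw [Subgroup.coe_mul, Subgroup.coe_inv, hzx]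
  -- the pointwise bound of the integrand by `D · 1_{z K⁻¹}`
  have hbound : ∀ y : infinitePart W, ‖finf y * e ((y : GA W)⁻¹ * GA.ofInfPart W x)‖ ≤
      (z • K⁻¹).indicator (fun _ => D) y := by
    intro y
    rw [hrw y]
    by_cases hy : y ∈ z • K⁻¹
    · rw [Set.indicator_of_mem hy, norm_mul]
      obtain ⟨w, hw, hyw⟩ := Set.mem_smul_set.1 hy
      have hw' : w⁻¹ ∈ K := Set.mem_inv.1 hw
      -- `z = y · w⁻¹` with `w⁻¹ ∈ K`: `archDist x ≤ archDist y + cK`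
      have hzy : (z : GA W) = (y : GA W) * ((w⁻¹ : infinitePart W) : GA W) := by
        rw [← hyw, smul_eq_mul, Subgroup.coe_mul, Subgroup.coe_inv, mul_inv_cancel_right]
      have h1 : archDist W x ≤ archDist W (y : GA W) + cK := by
        have h3 := archDist_mul_le W (y : GA W) ((w⁻¹ : infinitePart W) : GA W)
        have h4 := hcK' _ hw'
        rw [← hdz, hzy]
        linarith
      have h2 : ‖finf y‖ ≤ C * Real.exp (3 * cK) * Real.exp (-(3 * archDist W x)) := by
        calc ‖finf y‖ ≤ C * Real.exp (-(3 * archDist W (y : GA W))) := hC _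
          _ ≤ C * (Real.exp (3 * cK) * Real.exp (-(3 * archDist W x))) := by
              rw [← Real.exp_add]
              exact mul_le_mul_of_nonneg_left (Real.exp_le_exp.2 (by linarith)) hC0
          _ = C * Real.exp (3 * cK) * Real.exp (-(3 * archDist W x)) := by ring
      calc ‖finf y‖ * ‖e ((y⁻¹ * z : infinitePart W) : GA W)‖
          ≤ (C * Real.exp (3 * cK) * Real.exp (-(3 * archDist W x))) * M :=
            mul_le_mul h2 (hM _) (norm_nonneg _) (by positivity)
        _ = D := by rw [← hD]; ring
    · rw [Set.indicator_of_notMem hy]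
      -- off `z K⁻¹` the test factor vanishes
      have h0 : e ((y⁻¹ * z : infinitePart W) : GA W) = 0 := by
        by_contra hne
        apply hy
        have hmem : (y⁻¹ * z : infinitePart W) ∈ K := hsupp _ hne
        refine Set.mem_smul_set.2 ⟨(y⁻¹ * z)⁻¹, Set.inv_mem_inv.2 hmem, ?_⟩
        rw [smul_eq_mul, mul_inv_rev, inv_inv, mul_inv_cancel_left]
      rw [h0, mul_zero, norm_zero]
  -- the bound function is integrable (a constant on a compact set) and `μ_∞(z K⁻¹) = μ_∞(K⁻¹)`
  have hint : Integrable ((z • K⁻¹).indicator (fun _ => D)) μinf :=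
    (integrable_indicator_iff hzKm).2 (integrableOn_const hzK.measure_lt_top.ne)
  have hmeasz : μinf (z • K⁻¹) = μinf K⁻¹ := by
    rw [← Set.preimage_smul_inv z K⁻¹]
    exact measure_preimage_mul μinf z⁻¹ K⁻¹
  calc ‖convInf W μinf finf e x‖
      = ‖∫ y : infinitePart W, finf y * e ((y : GA W)⁻¹ * GA.ofInfPart W x) ∂μinf‖ := rfl
    _ ≤ ∫ y, (z • K⁻¹).indicator (fun _ => D) y ∂μinf :=
        norm_integral_le_of_norm_le hint (Filter.Eventually.of_forall hbound)
    _ = μinf.real (z • K⁻¹) * D := by rw [integral_indicator_const D hzKm, smul_eq_mul]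
    _ = C * Real.exp (3 * cK) * M * μinf.real K⁻¹ * Real.exp (-(3 * archDist W x)) := by
        rw [measureReal_def, hmeasz, ← measureReal_def, ← hD]
        ring

/-- **`finf ∗ e` inherits the weight-3 decay of `finf`** (`HasDecay3`, the shape display (8) `PoincareOfDecay` consumes). -/
theorem hasDecay3_convInf (μinf : Measure (infinitePart W)) [μinf.IsHaarMeasure] {finf e : GA W → ℂ}
    (hd : HasDecay3 W finf) (he : IsInfFactor W e) : HasDecay3 W (convInf W μinf finf e) := by
  obtain ⟨C, hC⟩ := hd
  have hC' : ∀ x, ‖finf x‖ ≤ max C 0 * Real.exp (-(3 * archDist W x)) := fun x =>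
    le_trans (hC x) (mul_le_mul_of_nonneg_right (le_max_left _ _) (Real.exp_pos _).le)
  obtain ⟨M, hM⟩ := (he.cont.comp continuous_subtype_val).bounded_above_of_compact_support he.compact
  obtain ⟨cK, -, hcK⟩ := exists_forall_archDist_le_of_isCompact W he.compact
  exact ⟨max C 0 * Real.exp (3 * cK) * M *
    μinf.real (tsupport (fun y : infinitePart W => e (y : GA W)))⁻¹,
    fun x => norm_convInf_le_exp_of_decay W μinf (le_max_right _ _) hC' he hM hcK x⟩

/-- `c₀ · (finf ∗ e)` inherits the weight-3 decay. -/
theorem hasDecay3_const_mul_convInf (μinf : Measure (infinitePart W)) [μinf.IsHaarMeasure] {finf e : GA W → ℂ}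
    (hd : HasDecay3 W finf) (he : IsInfFactor W e) (c₀ : ℂ) :
    HasDecay3 W (fun x => c₀ * convInf W μinf finf e x) := by
  obtain ⟨C, hC⟩ := hasDecay3_convInf W μinf hd he
  refine ⟨‖c₀‖ * C, fun x => ?_⟩
  rw [norm_mul, mul_assoc]
  exact mul_le_mul_of_nonneg_left (hC x) (norm_nonneg _)

/-- The sup bound of `c₀ · (finf ∗ e)` (`e^{−3 archDist} ≤ 1`). -/
theorem exists_norm_const_mul_convInf_le (μinf : Measure (infinitePart W)) [μinf.IsHaarMeasure] {finf e : GA W → ℂ}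
    (hd : HasDecay3 W finf) (he : IsInfFactor W e) (c₀ : ℂ) :
    ∃ C : ℝ, ∀ x, ‖c₀ * convInf W μinf finf e x‖ ≤ C := by
  obtain ⟨C, hC⟩ := hasDecay3_const_mul_convInf W μinf hd he c₀
  refine ⟨max C 0, fun x => le_trans (hC x) ?_⟩
  calc C * Real.exp (-(3 * archDist W x)) ≤ max C 0 * Real.exp (-(3 * archDist W x)) :=
        mul_le_mul_of_nonneg_right (le_max_left _ _) (Real.exp_pos _).le
    _ ≤ max C 0 * 1 := by
        refine mul_le_mul_of_nonneg_left ?_ (le_max_right _ _)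
        exact Real.exp_le_one_iff.2 (by linarith [archDist_nonneg W x])
    _ = max C 0 := mul_one _

end Decay

/-! ## The two archimedean `ChainInputs` clauses at `Finf := c₀ · (finf ∗ e)` -/

section Clauses

variable {k : Type} [Field k] [NumberField k] (W : PlaneData k) [MeasurableSpace (GA W)] [BorelSpace (GA W)]
  (R : RTFData W)

/-- **`ChainInputs.hA` at the witness's archimedean factor** (IntegArch's `integrable_conj_chi'_mul_Finf` by name). -/
theorem integrable_conj_chi'_mul_const_mul_convInf [CompactSpace (torusInf' W)] (hc' : Continuous R.chi')
    (hu' : ∀ a, ‖R.chi' a‖ = 1) (νinf' : Measure (torusInf' W)) [νinf'.IsHaarMeasure]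
    (μinf : Measure (infinitePart W)) [μinf.IsHaarMeasure] {finf : GA W → ℂ} (hfinf : Continuous finf)
    {e : GA W → ℂ} (he : IsInfFactor W e) (c₀ : ℂ) (γ₀ : GA W) (t : torusT W) :
    Integrable (fun a : torusInf' W => conj (R.chi' (a : torusT' W)) *
      (fun x => c₀ * convInf W μinf finf e x)
        ((GA.ofInfPart W t)⁻¹ * GA.ofInfPart W γ₀ * ((a : torusT' W) : GA W))) νinf' :=
  integrable_conj_chi'_mul_Finf W R hc' hu' νinf' _ (continuous_const_mul_convInf W μinf hfinf he c₀) γ₀ t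

/-- **`ChainInputs.hIinf` at the witness's archimedean factor** (IntegArch's `integrable_chi_mul_innerInf` by name). -/
theorem integrable_chi_mul_innerInf_const_mul_convInf [CompactSpace (torusInf W)] [CompactSpace (torusInf' W)]
    (hc : Continuous R.chi) (hu : ∀ a, ‖R.chi a‖ = 1) (hc' : Continuous R.chi') (hu' : ∀ a, ‖R.chi' a‖ = 1)
    (νinf : Measure (torusInf W)) [νinf.IsHaarMeasure] (νinf' : Measure (torusInf' W)) [νinf'.IsHaarMeasure]
    (μinf : Measure (infinitePart W)) [μinf.IsHaarMeasure] {finf : GA W → ℂ} (hfinf : Continuous finf)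
    {e : GA W → ℂ} (he : IsInfFactor W e) (c₀ : ℂ) (γ₀ : GA W) :
    Integrable (fun a : torusInf W =>
      R.chi a * innerInf W R (fun x => c₀ * convInf W μinf finf e x) γ₀ νinf' a) νinf :=
  integrable_chi_mul_innerInf W R hc hu hc' hu' νinf νinf' _ (continuous_const_mul_convInf W μinf hfinf he c₀) γ₀

end Clauses

end Summit.Ventures.HodgeRepro.Tier4.Line4

end
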